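import Summits.NavierStokesRegularity.NavierStokesRegularity.Theorems.TerminalTraceTypeITraceScarL3StubNoConfinedExtinctApex
import Literature.Analysis.FluidPDE.BlowupTopVanishing
import Literature.Analysis.FluidPDE.SliceL2Convergence
import Literature.Analysis.FluidPDE.SereginSverak2002WeakVanishing
import Literature.Analysis.FluidPDE.AncientLimitVanishingScaled
import HarnessLib

/-!
# Tools for the ZOOM packages of the line `radius_dichotomy` (stubs Z4/Z5 of item `TerminalTrace.TypeITraceScarL3`,
# stmt-NavierStokesRegularity-18385): a.e. bounds and the WEAK TOP-VANISHING pass to `L³` zoom limits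

Seat nsreg-C26-p1 g5 (cell ns-regularity-ideate), `--supports stmt-NavierStokesRegularity-18385` (helper).

* `ae_le_of_tendsto_eLpNorm_three` — an a.e. pointwise bound `‖F_j‖ ≤ b` holding for all large `j` passes to an `L³`
  limit (convergence in measure, a.e.-convergent subsequence);
* `weakNull_nsZoom` — the weak top-vanishing of an extinct apex is inherited by every zoom `c • U(c²·, c·)`
  about the origin (test against `φ(·/c)`; verbatim the step (iii) of `stub_no_confinedExtinctApex`);
* `exists_subseq_ae_tendsto_pairing_of_tendsto_eLpNorm` — `L³(Q(a))` convergence of space–time fields gives, along a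
  subsequence, convergence of the pairings `∫⟪F_j(s), φ⟫ → ∫⟪w(s), φ⟫` for a.e. `s ∈ ]−a², 0[` (the tree's
  `exists_subseq_ae_tendsto_lintegral_slice` + `tendsto_integral_inner_of_tendsto_lintegral`, for merely measurable
  fields with the slice facts from Tonelli);
* `weakNull_of_zoomLimit` — **zoom limits of extinct apices are extinct**: if `(U, P)` is suitable in every `Q(a)` with
  `cknAEss, cknD` bounded at the origin at radii `≤ 1/2` and weakly null at the top, and the zooms `λ_j U(λ_j²·, λ_j·)`,
  `λ_j → 0⁺`, converge in `L³(Q(a))` for every `a` to `w`, then `w` is weakly null at the top — by the UNIFORM pairing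
  modulus `exists_uniform_pairing_modulus_of_bounds` (ESS 2003 (3.13), constants independent of the scale):
  `|∫⟪U_j(s), φ⟫| ≤ A|s| + B|s|^{1/3}` for a.e. `s`, uniformly in `j`, hence for `w`.
WHAT THIS IS NOT: 18385 / NS regularity NOT proved. [folklore; EscauriazaSereginSverak2003 §3 (3.13); Seregin2014 §6.6]
-/

noncomputable section

set_option linter.dupNamespace false

namespace Summit.NavierStokesRegularity.NavierStokesRegularity.Theorems.TypeITraceScarL3

open MeasureTheory Set Function Filter Topology TopologicalSpace Metric InnerProductSpace
open Literature.Analysis.FluidPDE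
open scoped NNReal ENNReal RealInnerProductSpace

/-! ### A.e. bounds pass to `L³` limits -/

/-- If `F_j → V` in `L³(μ)` and, for all large `j`, `‖F_j z‖ ≤ b z` for `μ`-a.e. `z`, then `‖V z‖ ≤ b z` for `μ`-a.e. `z`
(convergence in measure and an a.e.-convergent subsequence). [folklore] -/
theorem ae_le_of_tendsto_eLpNorm_three {X : Type*} [MeasurableSpace X] {μ : Measure X}
    {F : ℕ → X → EuclideanSpace ℝ (Fin 3)} {V : X → EuclideanSpace ℝ (Fin 3)} {b : X → ℝ}
    (hF : ∀ j, AEStronglyMeasurable (F j) μ) (hV : AEStronglyMeasurable V μ)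
    (hconv : Tendsto (fun j => eLpNorm (F j - V) 3 μ) atTop (𝓝 0))
    (hb : ∀ᶠ j in atTop, ∀ᵐ z ∂μ, ‖F j z‖ ≤ b z) :
    ∀ᵐ z ∂μ, ‖V z‖ ≤ b z := by
  obtain ⟨J, hJ⟩ := eventually_atTop.1 hb
  have hmeas := tendstoInMeasure_of_tendsto_eLpNorm (by norm_num : (3 : ℝ≥0∞) ≠ 0) hF hV hconv
  obtain ⟨ns, hns, hae⟩ := hmeas.exists_seq_tendsto_ae
  have hall : ∀ᵐ z ∂μ, ∀ i : ℕ, ‖F (J + i) z‖ ≤ b z := by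
    rw [ae_all_iff]
    intro i
    exact hJ (J + i) (Nat.le_add_right _ _)
  filter_upwards [hae, hall] with z hz hzb
  have hlim : Tendsto (fun i => ‖F (ns i) z‖) atTop (𝓝 ‖V z‖) := hz.norm
  refine le_of_tendsto hlim ?_
  filter_upwards [eventually_ge_atTop J] with i hi
  have hnsJ : J ≤ ns i := hi.trans (hns.id_le i)
  have := hzb (ns i - J)
  rwa [Nat.add_sub_cancel' hnsJ] at this

/-! ### The weak top-vanishing is inherited by zooms -/

/-- **Zooms of an extinct apex are extinct**: if `U` is weakly null at the top time, so is `c • U(c²·, c·)` for every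
`c > 0` (test against `φ(·/c)`). [folklore] -/
theorem weakNull_nsZoom
    {U : ℝ → EuclideanSpace ℝ (Fin 3) → EuclideanSpace ℝ (Fin 3)}
    (htop : ∀ φ : EuclideanSpace ℝ (Fin 3) → EuclideanSpace ℝ (Fin 3), ContDiff ℝ (⊤ : ℕ∞) φ →
      HasCompactSupport φ → ∀ ε : ℝ, 0 < ε →
        ∃ s₀ : ℝ, s₀ < 0 ∧ ∀ᵐ s ∂(volume.restrict (Ioo s₀ 0)), |∫ y, ⟪U s y, φ y⟫| ≤ ε)
    {c : ℝ} (hc : 0 < c) :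
    ∀ φ : EuclideanSpace ℝ (Fin 3) → EuclideanSpace ℝ (Fin 3), ContDiff ℝ (⊤ : ℕ∞) φ →
      HasCompactSupport φ → ∀ ε : ℝ, 0 < ε →
        ∃ s₀ : ℝ, s₀ < 0 ∧ ∀ᵐ s ∂(volume.restrict (Ioo s₀ 0)),
          |∫ y, ⟪(c • stPull (c ^ 2) c (0 : ℝ) (0 : EuclideanSpace ℝ (Fin 3)) U) s y, φ y⟫| ≤ ε := by
  -- adapted from `stub_no_confinedExtinctApex`, step (iii)
  have hc0 : c ≠ 0 := hc.ne'
  have hc2 : 0 < c ^ 2 := pow_pos hc 2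
  have hU'apply : ∀ s y, (c • stPull (c ^ 2) c (0 : ℝ) (0 : EuclideanSpace ℝ (Fin 3)) U) s y =
      c • U (c ^ 2 * s) (c • y) := fun s y => by simp only [Pi.smul_apply, stPull_apply, zero_add]
  intro φ hφ hφc ε hε
  set φl : EuclideanSpace ℝ (Fin 3) → EuclideanSpace ℝ (Fin 3) := fun x => φ (c⁻¹ • x) with hφl
  have hφl_smooth : ContDiff ℝ (⊤ : ℕ∞) φl := hφ.comp (contDiff_const_smul _)
  have hφl_supp : HasCompactSupport φl := hφc.comp_smul (inv_ne_zero hc0)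
  obtain ⟨s₀, hs₀, hs₀ae⟩ := htop φl hφl_smooth hφl_supp (c ^ 2 * ε) (by positivity)
  refine ⟨s₀ / c ^ 2, div_neg_of_neg_of_pos hs₀ hc2, ?_⟩
  have hpair : ∀ s, ∫ y, ⟪(c • stPull (c ^ 2) c (0 : ℝ) (0 : EuclideanSpace ℝ (Fin 3)) U) s y, φ y⟫ =
      (c ^ 2)⁻¹ * ∫ x, ⟪U (c ^ 2 * s) x, φl x⟫ := by
    intro s
    have e1 : (fun y => ⟪(c • stPull (c ^ 2) c (0 : ℝ) (0 : EuclideanSpace ℝ (Fin 3)) U) s y, φ y⟫) =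
        fun y => c * (fun x => ⟪U (c ^ 2 * s) x, φl x⟫) (c • y) := by
      funext y
      rw [hU'apply, real_inner_smul_left, hφl]
      dsimp only
      rw [smul_smul, inv_mul_cancel₀ hc0, one_smul]
    rw [e1, integral_const_mul, Measure.integral_comp_smul_of_nonneg volume
      (fun x => ⟪U (c ^ 2 * s) x, φl x⟫) c (hR := hc.le), finrank_euclideanSpace_fin,
      smul_eq_mul, ← mul_assoc]
    congr 1
    field_simp
  have h1 := ae_restrict_comp_affine' measurableSet_Ioo hs₀ae (c := c ^ 2) (d := 0) hc2.ne'
    (S' := Ioo (s₀ / c ^ 2) 0) measurableSet_Ioo (fun s hs => by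
      rw [zero_add]
      refine ⟨?_, mul_neg_of_pos_of_neg hc2 hs.2⟩
      have := hs.1
      rw [div_lt_iff₀ hc2] at this
      linarith)
  filter_upwards [h1] with s hs
  rw [zero_add] at hs
  rw [hpair, abs_mul, abs_inv, abs_of_pos hc2]
  calc (c ^ 2)⁻¹ * |∫ x, ⟪U (c ^ 2 * s) x, φl x⟫| ≤ (c ^ 2)⁻¹ * (c ^ 2 * ε) :=
        mul_le_mul_of_nonneg_left hs (inv_nonneg.2 hc2.le)
    _ = ε := by field_simp

/-! ### Pairings converge along a subsequence at a.e. time -/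

/-- **`L³(Q(a))` convergence gives convergence of the pairings at a.e. time, along a subsequence.** If
`F_j → w` in `L³(Q(a))`, all fields a.e. strongly measurable and in `L³(Q(a))`, and `φ` is continuous, bounded,
vanishing off `B(0, a)`, then along a subsequence `∫⟪F_j(s), φ⟫ → ∫⟪w(s), φ⟫` for a.e. `s ∈ ]−a², 0[`
(the tree's slice-convergence lemmas; slice measurability and slice `L²` finiteness from Tonelli). [folklore] -/
theorem exists_subseq_ae_tendsto_pairing_of_tendsto_eLpNorm
    {F : ℕ → ℝ → EuclideanSpace ℝ (Fin 3) → EuclideanSpace ℝ (Fin 3)}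
    {w : ℝ → EuclideanSpace ℝ (Fin 3) → EuclideanSpace ℝ (Fin 3)} {a : ℝ}
    (hF3 : ∀ j, MemLp (uncurry (F j)) 3
      (volume.restrict (parabolicCylinder a (0 : ℝ × EuclideanSpace ℝ (Fin 3)))))
    (hw3 : MemLp (uncurry w) 3
      (volume.restrict (parabolicCylinder a (0 : ℝ × EuclideanSpace ℝ (Fin 3)))))
    (hconv : Tendsto (fun j => eLpNorm (uncurry (F j) - uncurry w) 3
        (volume.restrict (parabolicCylinder a (0 : ℝ × EuclideanSpace ℝ (Fin 3))))) atTop (𝓝 0))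
    {φ : EuclideanSpace ℝ (Fin 3) → EuclideanSpace ℝ (Fin 3)} (hφc : Continuous φ) {Mφ : ℝ}
    (hφM : ∀ y, ‖φ y‖ ≤ Mφ) (hφs : ∀ y, y ∉ ball (0 : EuclideanSpace ℝ (Fin 3)) a → φ y = 0) :
    ∃ κ : ℕ → ℕ, StrictMono κ ∧ ∀ᵐ s ∂(volume.restrict (Ioo (-a ^ 2) 0)),
      Tendsto (fun k => ∫ y, ⟪F (κ k) s y, φ y⟫) atTop (𝓝 (∫ y, ⟪w s y, φ y⟫)) := by
  -- adapted from `SereginSverak2002WeakVanishing.exists_subseq_ae_tendsto_pairing`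
  set I : Set ℝ := Ioo (-a ^ 2) 0 with hI
  set B : Set (EuclideanSpace ℝ (Fin 3)) := ball (0 : EuclideanSpace ℝ (Fin 3)) a with hB
  have hQ : parabolicCylinder a (0 : ℝ × EuclideanSpace ℝ (Fin 3)) = I ×ˢ B := by
    rw [parabolicCylinder]; simp [hI, hB]
  rw [hQ] at hF3 hw3 hconv
  have hIBm : MeasurableSet (I ×ˢ B) := measurableSet_Ioo.prod measurableSet_ball
  set μQ : Measure (ℝ × EuclideanSpace ℝ (Fin 3)) := volume.restrict (I ×ˢ B) with hμQ
  have hfinQ : volume (I ×ˢ B) < ⊤ :=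
    ((isCompact_Icc.prod (isCompact_closedBall _ _)).measure_lt_top).trans_le'
      (measure_mono (prod_mono Ioo_subset_Icc_self ball_subset_closedBall))
  haveI : IsFiniteMeasure μQ := ⟨by rw [hμQ, Measure.restrict_apply_univ]; exact hfinQ⟩
  have hfm : ∀ k, AEStronglyMeasurable (uncurry (F k)) μQ := fun k => (hF3 k).aestronglyMeasurable
  have hwm : AEStronglyMeasurable (uncurry w) μQ := hw3.aestronglyMeasurable
  -- `L³ → L²` on the finite measure `μQ`
  have h23 : ∀ {g : ℝ × EuclideanSpace ℝ (Fin 3) → EuclideanSpace ℝ (Fin 3)}, AEStronglyMeasurable g μQ →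
      ∫⁻ z, ‖g z‖ₑ ^ 2 ∂μQ ≤ (eLpNorm g 3 μQ * μQ univ ^ (1 / 2 - 1 / 3 : ℝ)) ^ 2 := by
    intro g hg
    have h1 := eLpNorm_le_eLpNorm_mul_rpow_measure_univ (p := 2) (q := 3) (μ := μQ) (by norm_num) hg
    have e : ∫⁻ z, ‖g z‖ₑ ^ 2 ∂μQ = eLpNorm g 2 μQ ^ 2 := by
      rw [eLpNorm_eq_lintegral_rpow_enorm_toReal two_ne_zero ENNReal.ofNat_ne_top]
      simp only [ENNReal.toReal_ofNat, ENNReal.rpow_ofNat, one_div]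
      rw [← ENNReal.rpow_natCast, ← ENNReal.rpow_mul]
      norm_num
    rw [e]
    simp only [ENNReal.toReal_ofNat] at h1
    gcongr
  have hL2 : Tendsto (fun k => ∫⁻ z in I ×ˢ B, ‖F k z.1 z.2 - w z.1 z.2‖ₑ ^ 2) atTop (𝓝 0) := by
    have hb : Tendsto (fun k => (eLpNorm (uncurry (F k) - uncurry w) 3 μQ * μQ univ ^ (1 / 2 - 1 / 3 : ℝ)) ^ 2)
        atTop (𝓝 0) := by
      have h1 := ENNReal.Tendsto.mul_const hconv (Or.inr (ENNReal.rpow_ne_top_of_nonneg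
        (by norm_num : (0 : ℝ) ≤ 1 / 2 - 1 / 3) (measure_ne_top μQ univ)))
      rw [zero_mul] at h1
      have h2 := ENNReal.Tendsto.pow (n := 2) h1
      rwa [zero_pow two_ne_zero] at h2
    refine tendsto_of_tendsto_of_tendsto_of_le_of_le tendsto_const_nhds hb (fun k => bot_le) fun k => ?_
    exact h23 ((hfm k).sub hwm)
  obtain ⟨τ, hτ, hae⟩ := exists_subseq_ae_tendsto_lintegral_slice (I := I) (B := B) hfm hwm hL2
  -- slice facts
  have hprod : μQ = (volume.restrict I).prod (volume.restrict B) := by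
    rw [hμQ, Measure.prod_restrict, ← Measure.volume_eq_prod]
  have hslice_m : ∀ {g : ℝ → EuclideanSpace ℝ (Fin 3) → EuclideanSpace ℝ (Fin 3)},
      AEStronglyMeasurable (uncurry g) μQ →
      ∀ᵐ s ∂(volume.restrict I), AEStronglyMeasurable (g s) (volume.restrict B) := by
    intro g hg
    rw [hprod] at hg
    exact hg.prodMk_left
  have hslice_2 : ∀ {g : ℝ → EuclideanSpace ℝ (Fin 3) → EuclideanSpace ℝ (Fin 3)},
      MemLp (uncurry g) 3 μQ → ∀ᵐ s ∂(volume.restrict I), ∫⁻ y in B, ‖g s y‖ₑ ^ 2 < ⊤ := by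
    intro g hg3
    have hgm : AEStronglyMeasurable (uncurry g) μQ := hg3.aestronglyMeasurable
    have hg2 : ∫⁻ z, ‖uncurry g z‖ₑ ^ 2 ∂μQ < ⊤ := by
      refine lt_of_le_of_lt (h23 hgm) ?_
      exact ENNReal.pow_lt_top (ENNReal.mul_lt_top hg3.eLpNorm_lt_top
        (ENNReal.rpow_lt_top_of_nonneg (by norm_num : (0 : ℝ) ≤ 1 / 2 - 1 / 3) (measure_ne_top μQ univ)))
    rw [hprod, lintegral_prod _ (hgm.aemeasurable.enorm.pow_const 2 |>.mono_measure (by rw [hprod]))] at hg2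
    refine ae_lt_top' ?_ hg2.ne
    exact ((hgm.aemeasurable.enorm.pow_const 2).mono_measure (by rw [hprod])).lintegral_prod_right'
  have hFm_all : ∀ᵐ s ∂(volume.restrict I), ∀ k, AEStronglyMeasurable (F k s) (volume.restrict B) := by
    rw [ae_all_iff]; intro k; exact hslice_m (hfm k)
  have hF2_all : ∀ᵐ s ∂(volume.restrict I), ∀ k, ∫⁻ y in B, ‖F k s y‖ₑ ^ 2 < ⊤ := by
    rw [ae_all_iff]; intro k; exact hslice_2 (hF3 k)
  refine ⟨τ, hτ, ?_⟩
  have hμB : (volume.restrict B) univ < ⊤ := by rw [Measure.restrict_apply_univ]; exact measure_ball_lt_top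
  filter_upwards [hae, hslice_m hwm, hslice_2 hw3, hFm_all, hF2_all] with s hs hsm hs2 hFm hF2
  have key := tendsto_integral_inner_of_tendsto_lintegral (μ := volume.restrict B)
    (f := fun k => F (τ k) s) (g := w s) (η := φ) (B := univ)
    (fun k => hFm (τ k)) hsm hφc.aestronglyMeasurable hφM hμB
    (fun y hy => absurd (mem_univ y) hy)
    (fun k => by rw [Measure.restrict_univ]; exact hF2 (τ k)) (by rwa [Measure.restrict_univ])
    (by simpa [Measure.restrict_univ] using hs)
  have hfull : ∀ g : EuclideanSpace ℝ (Fin 3) → EuclideanSpace ℝ (Fin 3),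
      ∫ y, ⟪g y, φ y⟫ ∂(volume.restrict B) = ∫ y, ⟪g y, φ y⟫ := by
    intro g
    exact setIntegral_eq_integral_of_forall_compl_eq_zero fun y hy => by rw [hφs y hy, inner_zero_right]
  simp only [hfull] at key
  exact key

/-! ### Zoom limits of extinct apices are extinct -/

set_option maxHeartbeats 1600000 in
/-- **The weak top-vanishing passes to zoom limits** (uniform pairing modulus, ESS 2003 (3.13)). Let `(U, P)` be
suitable in every `Q(a)` at the origin with `cknAEss r 0 U ≤ K`, `cknD r 0 P ≤ K` for `0 < r ≤ 1/2`, weakly null at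
the top time; let the zooms `λ_j U(λ_j²·, λ_j·)`, `λ_j → 0⁺`, lie in and converge in `L³(Q(a))` to `w ∈ L³(Q(a))` for
every `a > 0`. Then `w` is weakly null at the top time. [cite: EscauriazaSereginSverak2003, §3 (3.13)] -/
theorem weakNull_of_zoomLimit
    {U : ℝ → EuclideanSpace ℝ (Fin 3) → EuclideanSpace ℝ (Fin 3)}
    {P : ℝ → EuclideanSpace ℝ (Fin 3) → ℝ}
    (hsw : ∀ a : ℝ, 0 < a →
      IsSuitableWeakSolutionInBall a (0 : ℝ × EuclideanSpace ℝ (Fin 3)) U P)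
    {K : ℝ≥0}
    (hA : ∀ r ∈ Ioc (0 : ℝ) (1 / 2), cknAEss r (0 : ℝ × EuclideanSpace ℝ (Fin 3)) U ≤ K)
    (hD : ∀ r ∈ Ioc (0 : ℝ) (1 / 2), cknD r (0 : ℝ × EuclideanSpace ℝ (Fin 3)) P ≤ K)
    (htop : ∀ φ : EuclideanSpace ℝ (Fin 3) → EuclideanSpace ℝ (Fin 3), ContDiff ℝ (⊤ : ℕ∞) φ →
      HasCompactSupport φ → ∀ ε : ℝ, 0 < ε →
        ∃ s₀ : ℝ, s₀ < 0 ∧ ∀ᵐ s ∂(volume.restrict (Ioo s₀ 0)), |∫ y, ⟪U s y, φ y⟫| ≤ ε)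
    {lam : ℕ → ℝ} (hlam : ∀ j, 0 < lam j) (hlam0 : Tendsto lam atTop (𝓝 0))
    {w : ℝ → EuclideanSpace ℝ (Fin 3) → EuclideanSpace ℝ (Fin 3)}
    (hF3 : ∀ a : ℝ, 0 < a → ∀ j, MemLp
      (uncurry ((lam j) • stPull ((lam j) ^ 2) (lam j) (0 : ℝ) (0 : EuclideanSpace ℝ (Fin 3)) U)) 3
      (volume.restrict (parabolicCylinder a (0 : ℝ × EuclideanSpace ℝ (Fin 3)))))
    (hw3 : ∀ a : ℝ, 0 < a → MemLp (uncurry w) 3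
      (volume.restrict (parabolicCylinder a (0 : ℝ × EuclideanSpace ℝ (Fin 3)))))
    (hconv : ∀ a : ℝ, 0 < a → Tendsto (fun j => eLpNorm
        (uncurry ((lam j) • stPull ((lam j) ^ 2) (lam j) (0 : ℝ) (0 : EuclideanSpace ℝ (Fin 3)) U) -
          uncurry w) 3
        (volume.restrict (parabolicCylinder a (0 : ℝ × EuclideanSpace ℝ (Fin 3))))) atTop (𝓝 0)) :
    ∀ φ : EuclideanSpace ℝ (Fin 3) → EuclideanSpace ℝ (Fin 3), ContDiff ℝ (⊤ : ℕ∞) φ →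
      HasCompactSupport φ → ∀ ε : ℝ, 0 < ε →
        ∃ s₀ : ℝ, s₀ < 0 ∧ ∀ᵐ s ∂(volume.restrict (Ioo s₀ 0)), |∫ y, ⟪w s y, φ y⟫| ≤ ε := by
  intro φ hφ hφc ε hε
  -- the support radius `ρ ≥ 1`
  obtain ⟨Rφ, hRφ⟩ := hφc.isCompact.isBounded.subset_closedBall (0 : EuclideanSpace ℝ (Fin 3))
  set ρ : ℝ := max 1 (Rφ + 1) with hρdef
  have hρ1 : 1 ≤ ρ := le_max_left _ _
  have hρ : 0 < ρ := one_pos.trans_le hρ1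
  have hφρ : tsupport φ ⊆ ball (0 : EuclideanSpace ℝ (Fin 3)) ρ := fun x hx =>
    (closedBall_subset_ball (by rw [hρdef]; exact lt_of_lt_of_le (by linarith) (le_max_right _ _))) (hRφ hx)
  have hφs : ∀ y, y ∉ ball (0 : EuclideanSpace ℝ (Fin 3)) ρ → φ y = 0 := fun y hy =>
    image_eq_zero_of_notMem_tsupport fun h => hy (hφρ h)
  obtain ⟨Mφ, hMφ⟩ := hφ.continuous.bounded_above_of_compact_support hφc
  -- the uniform pairing modulus at the origin
  have hsol : IsDistributionalNSSolutionOn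
      (parabolicCylinderOpens (1 / 2) (0 : ℝ × EuclideanSpace ℝ (Fin 3))) 1 0 U P :=
    (hsw (1 / 2) (by norm_num)).1.distributional
  obtain ⟨A, B, hA0, hB0, hmod⟩ := exists_uniform_pairing_modulus_of_bounds hsol hA hD hφ hφc hρ1 hφρ
  simp only [Prod.fst_zero, Prod.snd_zero] at hmod
  -- the zoomed fields
  set F : ℕ → ℝ → EuclideanSpace ℝ (Fin 3) → EuclideanSpace ℝ (Fin 3) :=
    fun j => (lam j) • stPull ((lam j) ^ 2) (lam j) (0 : ℝ) (0 : EuclideanSpace ℝ (Fin 3)) U with hFdef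
  -- the uniform bound `|∫⟪F_j(s), φ⟫| ≤ A|s| + B|s|^{1/3}` for a.e. `s ∈ ]−ρ², 0[`, all large `j`
  have hev : ∀ᶠ j in atTop, ρ * lam j ≤ 1 / 2 := by
    have h1 : Tendsto (fun j => ρ * lam j) atTop (𝓝 (ρ * 0)) := hlam0.const_mul ρ
    rw [mul_zero] at h1
    exact h1.eventually (Iic_mem_nhds (by norm_num))
  have hunif : ∀ᶠ j in atTop, ∀ᵐ s ∂(volume.restrict (Ioo (-ρ ^ 2) 0)),
      |∫ y, ⟪F j s y, φ y⟫| ≤ A * |s| + B * |s| ^ (1 / 3 : ℝ) := by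
    filter_upwards [hev] with j hj
    obtain ⟨S, hS, hSS⟩ := hmod (lam j) (hlam j) hj
    -- the zoom is extinct: pairings small near the top
    have htopj := weakNull_nsZoom htop (hlam j) φ hφ hφc
    -- for a.e. `s`, and every `n`, there is `s' ∈ S` with `|s'| < 1/(n+1)` and `|pair(s')| ≤ 1/(n+1)`
    have hgood : ∀ n : ℕ, ∃ s' ∈ S, |s'| ≤ 1 / ((n : ℝ) + 1) ∧
        |∫ y, ⟪F j s' y, φ y⟫| ≤ 1 / ((n : ℝ) + 1) := by
      intro n
      have hn : (0 : ℝ) < 1 / ((n : ℝ) + 1) := by positivity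
      obtain ⟨s₀, hs₀, hs₀ae⟩ := htopj (1 / ((n : ℝ) + 1)) hn
      set b : ℝ := max (max s₀ (-ρ ^ 2)) (-(1 / ((n : ℝ) + 1))) with hbdef
      have hb0 : b < 0 := by
        rw [hbdef]
        refine max_lt (max_lt hs₀ (by nlinarith)) (by linarith)
      have hbs₀ : s₀ ≤ b := (le_max_left _ _).trans (le_max_left _ _)
      have hbρ : -ρ ^ 2 ≤ b := (le_max_right _ _).trans (le_max_left _ _)
      have hbn : -(1 / ((n : ℝ) + 1)) ≤ b := le_max_right _ _
      have h1 : ∀ᵐ s ∂(volume.restrict (Ioo b 0)), s ∈ S :=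
        ae_restrict_of_ae_restrict_of_subset (Ioo_subset_Ioo hbρ le_rfl) hS
      have h2 : ∀ᵐ s ∂(volume.restrict (Ioo b 0)), |∫ y, ⟪F j s y, φ y⟫| ≤ 1 / ((n : ℝ) + 1) :=
        ae_restrict_of_ae_restrict_of_subset (Ioo_subset_Ioo hbs₀ le_rfl) hs₀ae
      have h3 : ∀ᵐ s ∂(volume.restrict (Ioo b 0)), s ∈ Ioo b 0 := ae_restrict_mem measurableSet_Ioo
      have hne : (volume.restrict (Ioo b 0)) ≠ 0 := by
        rw [Ne, Measure.restrict_eq_zero, Real.volume_Ioo]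
        exact (ENNReal.ofReal_pos.2 (by linarith)).ne'
      haveI : (ae (volume.restrict (Ioo b 0))).NeBot := ae_neBot.2 hne
      obtain ⟨s', hs'S, hs'le, hs'mem⟩ := (h1.and (h2.and h3)).exists
      refine ⟨s', hs'S, ?_, hs'le⟩
      rw [abs_of_neg hs'mem.2]
      linarith [hs'mem.1]
    choose sq hsqS hsqabs hsqpair using hgood
    filter_upwards [hS] with s hs
    -- `|pair(s)| ≤ |pair(s) − pair(s'_n)| + |pair(s'_n)| ≤ A|s − s'_n| + B|s − s'_n|^{1/3} + 1/(n+1)` and let `n → ∞`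
    have hbound : ∀ n : ℕ, |∫ y, ⟪F j s y, φ y⟫| ≤
        A * |s - sq n| + B * |s - sq n| ^ (1 / 3 : ℝ) + 1 / ((n : ℝ) + 1) := by
      intro n
      have h1 := hSS s hs (sq n) (hsqS n)
      have h2 := hsqpair n
      have htri : |∫ y, ⟪F j s y, φ y⟫| ≤
          |(∫ y, ⟪F j s y, φ y⟫) - ∫ y, ⟪F j (sq n) y, φ y⟫| + |∫ y, ⟪F j (sq n) y, φ y⟫| := by
        have := abs_sub_abs_le_abs_sub (∫ y, ⟪F j s y, φ y⟫) (∫ y, ⟪F j (sq n) y, φ y⟫)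
        linarith
      linarith
    have hlim : Tendsto (fun n : ℕ => A * |s - sq n| + B * |s - sq n| ^ (1 / 3 : ℝ) + 1 / ((n : ℝ) + 1))
        atTop (𝓝 (A * |s| + B * |s| ^ (1 / 3 : ℝ) + 0)) := by
      have hsq0 : Tendsto sq atTop (𝓝 0) := by
        refine squeeze_zero_norm (fun n => ?_) tendsto_one_div_add_atTop_nhds_zero_nat
        rw [Real.norm_eq_abs]
        exact hsqabs n
      have h1 : Tendsto (fun n => |s - sq n|) atTop (𝓝 |s|) := by
        have := (tendsto_const_nhds (x := s)).sub hsq0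
        rw [sub_zero] at this
        exact this.abs
      have h2 : Tendsto (fun n => |s - sq n| ^ (1 / 3 : ℝ)) atTop (𝓝 (|s| ^ (1 / 3 : ℝ))) :=
        h1.rpow_const (Or.inr (by norm_num))
      exact ((h1.const_mul A).add (h2.const_mul B)).add tendsto_one_div_add_atTop_nhds_zero_nat
    have := ge_of_tendsto' hlim hbound
    rwa [add_zero] at this
  -- pass to the limit along a subsequence at a.e. time
  obtain ⟨κ, hκ, hae⟩ := exists_subseq_ae_tendsto_pairing_of_tendsto_eLpNorm (hF3 ρ hρ) (hw3 ρ hρ)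
    (hconv ρ hρ) hφ.continuous hMφ hφs
  have hunifκ : ∀ᵐ s ∂(volume.restrict (Ioo (-ρ ^ 2) 0)), ∀ᶠ k in atTop,
      |∫ y, ⟪F (κ k) s y, φ y⟫| ≤ A * |s| + B * |s| ^ (1 / 3 : ℝ) := by
    obtain ⟨J, hJ⟩ := eventually_atTop.1 hunif
    have hall : ∀ᵐ s ∂(volume.restrict (Ioo (-ρ ^ 2) 0)), ∀ i : ℕ,
        |∫ y, ⟪F (J + i) s y, φ y⟫| ≤ A * |s| + B * |s| ^ (1 / 3 : ℝ) := by
      rw [ae_all_iff]; intro i; exact hJ (J + i) (Nat.le_add_right _ _)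
    filter_upwards [hall] with s hs
    filter_upwards [eventually_ge_atTop J] with k hk
    have hκJ : J ≤ κ k := hk.trans (hκ.id_le k)
    have := hs (κ k - J)
    rwa [Nat.add_sub_cancel' hκJ] at this
  have hwbound : ∀ᵐ s ∂(volume.restrict (Ioo (-ρ ^ 2) 0)),
      |∫ y, ⟪w s y, φ y⟫| ≤ A * |s| + B * |s| ^ (1 / 3 : ℝ) := by
    filter_upwards [hae, hunifκ] with s hs hsb
    exact le_of_tendsto hs.abs hsb
  -- choose `s₀`
  set C : ℝ := max A B with hCdef
  have hC0 : 0 ≤ C := hA0.trans (le_max_left _ _)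
  obtain ⟨δ, hδ, hδ1, hδC⟩ := SereginSverak2002.exists_delta_modulus_le hC0 hε
  set s₀ : ℝ := max (-δ / 2) (-ρ ^ 2 / 2) with hs₀def
  have hs₀neg : s₀ < 0 := by
    rw [hs₀def]; exact max_lt (by linarith) (by nlinarith)
  refine ⟨s₀, hs₀neg, ?_⟩
  have hsub : Ioo s₀ 0 ⊆ Ioo (-ρ ^ 2) 0 := Ioo_subset_Ioo (by
    rw [hs₀def]; refine le_trans (by nlinarith) (le_max_right _ _)) le_rfl
  filter_upwards [ae_restrict_of_ae_restrict_of_subset hsub hwbound, ae_restrict_mem measurableSet_Ioo]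
    with s hs hsI
  have hsδ : |s| < δ := by
    rw [abs_of_neg hsI.2]
    have : -δ / 2 ≤ s₀ := le_max_left _ _
    linarith [hsI.1]
  calc |∫ y, ⟪w s y, φ y⟫| ≤ A * |s| + B * |s| ^ (1 / 3 : ℝ) := hs
    _ ≤ C * |s| + C * |s| ^ (1 / 3 : ℝ) := by
        gcongr
        · exact le_max_left _ _
        · exact le_max_right _ _
    _ = C * (|s| + |s| ^ (1 / 3 : ℝ)) := by ring
    _ ≤ ε := hδC s hsδ

end Summit.NavierStokesRegularity.NavierStokesRegularity.Theorems.TypeITraceScarL3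

end
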